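import Literature.Topology.FourManifolds.GluckTwistHomology
import Literature.Topology.FourManifolds.MappingTorus
import Mathlib.Analysis.Convex.Contractible
import HarnessLib

/-!
# The Wang sequence of a glued mapping torus: a vanishing criterion for `H₂` (Hatcher Ex. 2.48)

For a glued mapping torus `Y = jA(N × (0, 1)) ∪ jB(N × (1/2, 3/2))` of a self-map `ψ : N → N`
(two open topological embeddings covering `Y` and identifying exactly the
`mappingTorusRel ψ`-related points — the topological content of `Literature.Topology.FourManifolds.IsMappingTorusOf` /
`Literature.IsOpenGluingWith … (mappingTorusRel ψ)`, packaged as `Literature.Topology.FourManifolds.MappingTorusDatum`), the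
Mayer–Vietoris sequence of the cover by the two cylinders `U = jA(…)`, `V = jB(…)` is the Wang
sequence `… → Hₙ(N) →(1 - ψ_*) Hₙ(N) → Hₙ(Y) → Hₙ₋₁(N) →(1 - ψ_*) Hₙ₋₁(N) → …` (Hatcher,
*Algebraic Topology*, §2.2, Exercise 2.48). This file proves the consequence needed for the
Cappell–Shaneson computation (`CappellShanesonHomology.lean`, named fact
`Literature.Topology.FourManifolds.isZero_singularHomology_two_mappingTorus_compl_sectionCircle`):

**`MappingTorusDatum.isZero_singularHomology_two`**: if `ψ_* - 1` is a monomorphism on `H₁(N; M)`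
and an epimorphism on `H₂(N; M)`, then `H₂(Y; M) = 0` — granted excision and the Mayer–Vietoris
exactness facts `exact₁`, `exact₂` of `Literature.AlgebraicTopology.SingularHomology.ExcisionMayerVietoris`
(Hatcher Thm. 2.20, §2.2), taken as hypotheses, for any coefficients `R`, `M`.

## The argument

* The overlap `W = U ∩ V = jA(N × ((0, 1) ∖ {1/2}))` is the disjoint union of the open cylinders
  `C₊ = jA(N × (1/2, 1))` and `C₋ = jA(N × (0, 1/2))`; Mayer–Vietoris for this disjoint cover of
  `W` (with `H_*(∅) = 0`, `isZero_singularHomology_of_isEmpty`) gives the additivity isomorphism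
  `Hₖ(C₊) ⊞ Hₖ(C₋) ≅ Hₖ(W)` for `k ≥ 1` (`isIso_ψ_overlap`).
* All four cylinders `U`, `V`, `C₊`, `C₋` project to `N` by homotopy equivalences (contractible
  interval factors); on `C₊` the two projections through `U` and `V` agree, on `C₋` they differ
  by `ψ` (`jA (x, s) = jB (ψ x, s + 1)` for `s < 1/2`). Precomposing the Mayer–Vietoris map
  `φₖ : Hₖ(W) → Hₖ(U) ⊞ Hₖ(V)` with the sections `N → C±` and following it by the projections
  turns it into the **Wang matrix** `L = [[1, 1], [-1, -ψ_*]]` on `Hₖ(N) ⊞ Hₖ(N)`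
  (`wangMatrix_eq`), which is mono, resp. epi, as soon as `ψ_* - 1` is (`mono_wangMatrix`,
  `epi_wangMatrix`: `L(a, b) = 0` forces `b = -a`, `(ψ_* - 1) a = 0`).
* Hence `φ₁` is mono and `φ₂` is epi, so in `H₂(U) ⊞ H₂(V) →ψ₂ H₂(Y) →δ H₁(W) →φ₁ …` we get
  `δ = 0`, `ψ₂ = 0` and `ψ₂` epi (exactness at `H₂(Y)`), i.e. `H₂(Y) = 0`.

## Main definitions and statements (all proved)

* `Literature.MappingTorusDatum ψ Y`, `Cplus`, `Cminus`, `overlap`, `P`, `Q`, `homeomorphP/Q`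
  (`C± ≃ₜ N × interval`), `projA`, `projB`, `secP`, `secQ` and the four identities
  `projA ∘ secP = projB ∘ secP = projA ∘ secQ = id`, `projB ∘ secQ = ψ`.
* `Literature.Topology.FourManifolds.isZero_singularHomology_of_isEmpty`, `Literature.Topology.FourManifolds.isIso_biprod_map`.
* `Literature.Topology.FourManifolds.wangMatrix`, `Literature.Topology.FourManifolds.mono_wangMatrix`, `Literature.Topology.FourManifolds.epi_wangMatrix`,
  `Literature.Topology.FourManifolds.MappingTorusDatum.isIso_ψ_overlap`, `Literature.Topology.FourManifolds.MappingTorusDatum.wangMatrix_eq`,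
  `Literature.Topology.FourManifolds.MappingTorusDatum.isZero_singularHomology_two`.

## References

* A. Hatcher, *Algebraic Topology* (2002), §2.2 (Mayer–Vietoris sequences, p. 149), Exercise 2.48
  (the exact sequence of a mapping torus), Thm. 2.20 [HatcherAT2002].
* S. E. Cappell, J. L. Shaneson, *Some new four-manifolds*, Ann. of Math. 104 (1976) 61–72, §1–2
  [CappellShanesonAnnals1976].

## Design notes

* Universes: the spaces `N`, `Y` share one universe `u` (homology transport lemmas need it); the
  coefficients `R`, `M` live in `v`, as in `ExcisionMayerVietoris.lean`.
* Only the topology of the gluing is used; `ψ` is a continuous map (a `C(N, N)`) in the homology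
  section, an arbitrary function in the set-theoretic part.
* No declaration in this file uses `sorry`.
-/

noncomputable section

open Set Function CategoryTheory Limits Topology
open scoped Topology

universe u v

namespace Literature.Topology.FourManifolds

/-! ### The open pieces of a glued mapping torus -/

section Datum

variable {N : Type u} [TopologicalSpace N] {ψ : N → N} {Y : Type v} [TopologicalSpace Y]

/-- The topological data of a **glued mapping torus** `Y = jA(N × (0, 1)) ∪ jB(N × (1/2, 3/2))` of a
self-map `ψ` of `N`: two open topological embeddings covering `Y` and identifying exactly the
`mappingTorusRel ψ`-related points (`jA (x, s) = jB (y, t) ↔ (t = s ∧ y = x) ∨ (t = s + 1 ∧ y = ψ x)`),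
i.e. the body of `Literature.Topology.FourManifolds.IsMappingTorusOf` / `Literature.IsOpenGluingWith … (mappingTorusRel ψ)` with the
smoothness forgotten (Hatcher, *Algebraic Topology*, Ex. 2.48; Cappell–Shaneson, Ann. of Math. 104
(1976), §1). [folklore] -/
structure MappingTorusDatum (ψ : N → N) (Y : Type v) [TopologicalSpace Y] where
  /-- The gluing map of the first cylinder `N × (0, 1)`. -/
  jA : N × ↥mappingTorusPieceOne → Y
  /-- The gluing map of the second cylinder `N × (1/2, 3/2)`. -/
  jB : N × ↥mappingTorusPieceTwo → Y
  /-- `jA` is a topological embedding. -/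
  hA : IsEmbedding jA
  /-- The range of `jA` is open. -/
  hAo : IsOpen (range jA)
  /-- `jB` is a topological embedding. -/
  hB : IsEmbedding jB
  /-- The range of `jB` is open. -/
  hBo : IsOpen (range jB)
  /-- The two ranges cover `Y`. -/
  hU : range jA ∪ range jB = univ
  /-- The gluing relation. -/
  hR : ∀ a b, jA a = jB b ↔ mappingTorusRel ψ a b

namespace MappingTorusDatum

variable (G : MappingTorusDatum ψ Y)

/-- A point `jA (x, s)` lies in the second cylinder iff `s ≠ 1/2`: for `s > 1/2` it is
`jB (x, s)`, for `s < 1/2` it is `jB (ψ x, s + 1)`. [folklore] -/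
theorem jA_mem_range_jB_iff (a : N × ↥mappingTorusPieceOne) :
    G.jA a ∈ range G.jB ↔ (a.2 : ℝ) ≠ 1 / 2 := by
  obtain ⟨x, s, hs0, hs1⟩ := a
  constructor
  · rintro ⟨⟨y, t, ht0, ht1⟩, h⟩
    rcases (G.hR _ _).1 h.symm with ⟨ht, -⟩ | ⟨ht, -⟩
    · simp only at ht ⊢
      intro hs; rw [hs] at ht; rw [ht] at ht0; norm_num at ht0
    · simp only at ht ⊢
      intro hs; rw [hs] at ht; rw [ht] at ht1; norm_num at ht1
  · intro hs
    rcases lt_or_gt_of_ne hs with hs | hs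
    · have ht : s + 1 ∈ Ioo (1 / 2 : ℝ) (3 / 2) := ⟨by linarith, by linarith⟩
      exact ⟨(ψ x, ⟨s + 1, ht⟩), ((G.hR _ _).2 (Or.inr ⟨rfl, rfl⟩)).symm⟩
    · have ht : s ∈ Ioo (1 / 2 : ℝ) (3 / 2) := ⟨hs, by linarith⟩
      exact ⟨(x, ⟨s, ht⟩), ((G.hR _ _).2 (Or.inl ⟨rfl, rfl⟩)).symm⟩

/-- `jA(N × (0, 1)) ∩ jB(N × (1/2, 3/2)) = jA(N × ((0, 1) ∖ {1/2}))`. [folklore] -/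
theorem range_jA_inter_range_jB :
    range G.jA ∩ range G.jB = G.jA '' {a | (a.2 : ℝ) ≠ 1 / 2} := by
  ext y
  constructor
  · rintro ⟨⟨a, rfl⟩, hyB⟩
    exact ⟨a, (G.jA_mem_range_jB_iff a).1 hyB, rfl⟩
  · rintro ⟨a, ha, rfl⟩
    exact ⟨mem_range_self _, (G.jA_mem_range_jB_iff a).2 ha⟩

/-- The upper overlap `C₊ = jA(N × (1/2, 1))`. [folklore] -/
def Cplus : Set Y := G.jA '' {a | (1 / 2 : ℝ) < a.2}

/-- The lower overlap `C₋ = jA(N × (0, 1/2))`. [folklore] -/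
def Cminus : Set Y := G.jA '' {a | (a.2 : ℝ) < 1 / 2}

/-- `jA` is an open embedding. [folklore] -/
theorem isOpenEmbedding_jA : IsOpenEmbedding G.jA := ⟨G.hA, G.hAo⟩

/-- `jB` is an open embedding. [folklore] -/
theorem isOpenEmbedding_jB : IsOpenEmbedding G.jB := ⟨G.hB, G.hBo⟩

/-- `jA` is continuous. [folklore] -/
theorem continuous_jA : Continuous G.jA := G.hA.continuous

/-- `jB` is continuous. [folklore] -/
theorem continuous_jB : Continuous G.jB := G.hB.continuous

/-- `C₊` is open. [folklore] -/
theorem isOpen_Cplus : IsOpen G.Cplus :=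
  G.isOpenEmbedding_jA.isOpenMap _
    (isOpen_lt continuous_const (continuous_subtype_val.comp continuous_snd))

/-- `C₋` is open. [folklore] -/
theorem isOpen_Cminus : IsOpen G.Cminus :=
  G.isOpenEmbedding_jA.isOpenMap _
    (isOpen_lt (continuous_subtype_val.comp continuous_snd) continuous_const)

/-- Membership in `C₊`. [folklore] -/
theorem jA_mem_Cplus_iff (a : N × ↥mappingTorusPieceOne) : G.jA a ∈ G.Cplus ↔ (1 / 2 : ℝ) < a.2 := by
  constructor
  · rintro ⟨a', ha', h⟩
    rw [G.hA.injective h] at ha'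
    exact ha'
  · exact fun h => ⟨a, h, rfl⟩

/-- Membership in `C₋`. [folklore] -/
theorem jA_mem_Cminus_iff (a : N × ↥mappingTorusPieceOne) : G.jA a ∈ G.Cminus ↔ (a.2 : ℝ) < 1 / 2 := by
  constructor
  · rintro ⟨a', ha', h⟩
    rw [G.hA.injective h] at ha'
    exact ha'
  · exact fun h => ⟨a, h, rfl⟩

/-- The overlap is the disjoint union of `C₊` and `C₋`. [folklore] -/
theorem Cplus_union_Cminus : G.Cplus ∪ G.Cminus = range G.jA ∩ range G.jB := by
  rw [G.range_jA_inter_range_jB]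
  ext y
  constructor
  · rintro (⟨a, ha, rfl⟩ | ⟨a, ha, rfl⟩)
    · exact ⟨a, ne_of_gt ha, rfl⟩
    · exact ⟨a, ne_of_lt ha, rfl⟩
  · rintro ⟨a, ha, rfl⟩
    rcases lt_or_gt_of_ne ha with h | h
    · exact Or.inr ⟨a, h, rfl⟩
    · exact Or.inl ⟨a, h, rfl⟩

/-- `C₊` and `C₋` are disjoint. [folklore] -/
theorem Cplus_inter_Cminus : G.Cplus ∩ G.Cminus = ∅ := by
  ext y
  simp only [mem_inter_iff, mem_empty_iff_false, iff_false, not_and]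
  rintro ⟨a, ha, rfl⟩ h
  have h' := (G.jA_mem_Cminus_iff a).1 h
  exact lt_asymm ha h'

/-- On `C₊` the two cylinder coordinates have the same `N`-component: `jA (x, s) = jB (x, s)`.
[folklore] -/
theorem jA_eq_jB_of_gt (x : N) (s : ↥mappingTorusPieceOne) (hs : (1 / 2 : ℝ) < s) :
    G.jA (x, s) = G.jB (x, ⟨s, hs, by linarith [s.2.2]⟩) :=
  (G.hR _ _).2 (Or.inl ⟨rfl, rfl⟩)

/-- On `C₋` the `N`-components differ by the monodromy: `jA (x, s) = jB (ψ x, s + 1)`. [folklore] -/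
theorem jA_eq_jB_of_lt (x : N) (s : ↥mappingTorusPieceOne) (hs : (s : ℝ) < 1 / 2) :
    G.jA (x, s) = G.jB (ψ x, ⟨s + 1, by linarith [s.2.1], by linarith⟩) :=
  (G.hR _ _).2 (Or.inr ⟨rfl, rfl⟩)

/-! #### The fibre projections of the pieces -/

/-- `N × (0, 1) ≃ₜ jA(N × (0, 1))`. [folklore] -/
def homeomorphA : N × ↥mappingTorusPieceOne ≃ₜ ↥(range G.jA) := G.hA.toHomeomorph

/-- `N × (1/2, 3/2) ≃ₜ jB(N × (1/2, 3/2))`. [folklore] -/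
def homeomorphB : N × ↥mappingTorusPieceTwo ≃ₜ ↥(range G.jB) := G.hB.toHomeomorph

/-- Values of `homeomorphA`. [folklore] -/
@[simp] theorem homeomorphA_apply (a : N × ↥mappingTorusPieceOne) :
    (G.homeomorphA a : Y) = G.jA a := rfl

/-- Values of `homeomorphB`. [folklore] -/
@[simp] theorem homeomorphB_apply (b : N × ↥mappingTorusPieceTwo) :
    (G.homeomorphB b : Y) = G.jB b := rfl

/-- `homeomorphA.symm (jA a) = a`. [folklore] -/
theorem homeomorphA_symm_apply (a : N × ↥mappingTorusPieceOne) :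
    G.homeomorphA.symm ⟨G.jA a, mem_range_self a⟩ = a :=
  G.homeomorphA.symm_apply_eq.2 rfl

/-- `homeomorphB.symm (jB b) = b`. [folklore] -/
theorem homeomorphB_symm_apply (b : N × ↥mappingTorusPieceTwo) :
    G.homeomorphB.symm ⟨G.jB b, mem_range_self b⟩ = b :=
  G.homeomorphB.symm_apply_eq.2 rfl

/-- `jA (homeomorphA.symm y) = y`. [folklore] -/
theorem jA_homeomorphA_symm (y : ↥(range G.jA)) : G.jA (G.homeomorphA.symm y) = y :=
  congrArg Subtype.val (G.homeomorphA.apply_symm_apply y)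

/-- The fibre projection `jA(N × (0, 1)) → N`, `jA (x, s) ↦ x`. [folklore] -/
def projA : C(↥(range G.jA), N) :=
  ContinuousMap.fst.comp (G.homeomorphA.symm : C(↥(range G.jA), N × ↥mappingTorusPieceOne))

/-- The fibre projection `jB(N × (1/2, 3/2)) → N`, `jB (y, t) ↦ y`. [folklore] -/
def projB : C(↥(range G.jB), N) :=
  ContinuousMap.fst.comp (G.homeomorphB.symm : C(↥(range G.jB), N × ↥mappingTorusPieceTwo))

/-- `projA (jA (x, s)) = x`. [folklore] -/
@[simp] theorem projA_apply_jA (a : N × ↥mappingTorusPieceOne) :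
    G.projA ⟨G.jA a, mem_range_self a⟩ = a.1 := by
  simp [projA, homeomorphA_symm_apply]

/-- `projB (jB (y, t)) = y`. [folklore] -/
@[simp] theorem projB_apply_jB (b : N × ↥mappingTorusPieceTwo) :
    G.projB ⟨G.jB b, mem_range_self b⟩ = b.1 := by
  simp [projB, homeomorphB_symm_apply]

/-- On `C₊`, the two fibre projections agree. [folklore] -/
theorem projB_eq_projA_of_mem_Cplus {y : Y} (hy : y ∈ G.Cplus) (hyA : y ∈ range G.jA)
    (hyB : y ∈ range G.jB) : G.projB ⟨y, hyB⟩ = G.projA ⟨y, hyA⟩ := by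
  obtain ⟨⟨x, s⟩, hs, rfl⟩ := hy
  have hs' : (1 / 2 : ℝ) < s := hs
  have h := G.jA_eq_jB_of_gt x s hs'
  have e1 : (⟨G.jA (x, s), hyB⟩ : ↥(range G.jB)) =
      ⟨G.jB (x, ⟨s, hs', by linarith [s.2.2]⟩), mem_range_self _⟩ :=
    Subtype.ext h
  rw [e1, projB_apply_jB, projA_apply_jA]

/-- On `C₋`, the fibre projections differ by the monodromy `ψ`. [folklore] -/
theorem projB_eq_apply_projA_of_mem_Cminus {y : Y} (hy : y ∈ G.Cminus) (hyA : y ∈ range G.jA)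
    (hyB : y ∈ range G.jB) : G.projB ⟨y, hyB⟩ = ψ (G.projA ⟨y, hyA⟩) := by
  obtain ⟨⟨x, s⟩, hs, rfl⟩ := hy
  have hs' : (s : ℝ) < 1 / 2 := hs
  have h := G.jA_eq_jB_of_lt x s hs'
  have e1 : (⟨G.jA (x, s), hyB⟩ : ↥(range G.jB)) =
      ⟨G.jB (ψ x, ⟨s + 1, by linarith [s.2.1], by linarith⟩), mem_range_self _⟩ :=
    Subtype.ext h
  rw [e1, projB_apply_jB, projA_apply_jA]

end MappingTorusDatum

end Datum

end Literature.Topology.FourManifolds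

namespace Literature.Topology.FourManifolds

/-! ### The two overlaps as cylinders -/

section Cylinders

variable {N : Type u} [TopologicalSpace N] {ψ : N → N} {Y : Type v} [TopologicalSpace Y]
  (G : MappingTorusDatum ψ Y)

/-- The upper half-interval `(1/2, 1) ⊆ (0, 1)`. [folklore] -/
abbrev Jplus : Type := {s : ↥mappingTorusPieceOne // (1 / 2 : ℝ) < s}

/-- The lower half-interval `(0, 1/2) ⊆ (0, 1)`. [folklore] -/
abbrev Jminus : Type := {s : ↥mappingTorusPieceOne // (s : ℝ) < 1 / 2}

/-- `(0, 1)` is contractible. [folklore] -/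
instance contractibleSpace_mappingTorusPieceOne : ContractibleSpace ↥mappingTorusPieceOne :=
  (convex_Ioo (0 : ℝ) 1).contractibleSpace ⟨1 / 2, by norm_num⟩

/-- `(1/2, 3/2)` is contractible. [folklore] -/
instance contractibleSpace_mappingTorusPieceTwo : ContractibleSpace ↥mappingTorusPieceTwo :=
  (convex_Ioo (1 / 2 : ℝ) (3 / 2)).contractibleSpace ⟨1, by norm_num⟩

/-- `(1/2, 1) ≃ₜ` the real interval. [folklore] -/
def jplusHomeomorph : Jplus ≃ₜ ↥(Ioo (1 / 2 : ℝ) 1) where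
  toFun s := ⟨s.1, s.2, s.1.2.2⟩
  invFun t := ⟨⟨t, by linarith [t.2.1], t.2.2⟩, t.2.1⟩
  left_inv _ := rfl
  right_inv _ := rfl
  continuous_toFun := by fun_prop
  continuous_invFun := by fun_prop

/-- `(0, 1/2) ≃ₜ` the real interval. [folklore] -/
def jminusHomeomorph : Jminus ≃ₜ ↥(Ioo (0 : ℝ) (1 / 2)) where
  toFun s := ⟨s.1, s.1.2.1, s.2⟩
  invFun t := ⟨⟨t, t.2.1, by linarith [t.2.2]⟩, t.2.2⟩
  left_inv _ := rfl
  right_inv _ := rfl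
  continuous_toFun := by fun_prop
  continuous_invFun := by fun_prop

/-- `(1/2, 1)` is contractible. [folklore] -/
instance contractibleSpace_jplus : ContractibleSpace Jplus :=
  haveI := (convex_Ioo (1 / 2 : ℝ) 1).contractibleSpace ⟨3 / 4, by norm_num⟩
  jplusHomeomorph.contractibleSpace

/-- `(0, 1/2)` is contractible. [folklore] -/
instance contractibleSpace_jminus : ContractibleSpace Jminus :=
  haveI := (convex_Ioo (0 : ℝ) (1 / 2)).contractibleSpace ⟨1 / 4, by norm_num⟩
  jminusHomeomorph.contractibleSpace

namespace MappingTorusDatum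

/-- The overlap `W = jA(N × (0, 1)) ∩ jB(N × (1/2, 3/2))` as a subset of `Y`. [folklore] -/
abbrev overlap : Set Y := range G.jA ∩ range G.jB

/-- The upper overlap seen inside `W`. [folklore] -/
abbrev P : Set ↥G.overlap := Subtype.val ⁻¹' G.Cplus

/-- The lower overlap seen inside `W`. [folklore] -/
abbrev Q : Set ↥G.overlap := Subtype.val ⁻¹' G.Cminus

/-- `W = P ∪ Q` is an open cover. [folklore] -/
theorem interior_P_union_interior_Q : interior G.P ∪ interior G.Q = univ := by
  rw [(G.isOpen_Cplus.preimage continuous_subtype_val).interior_eq,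
    (G.isOpen_Cminus.preimage continuous_subtype_val).interior_eq]
  refine eq_univ_of_forall fun w => ?_
  have hw : (w : Y) ∈ G.Cplus ∪ G.Cminus := by rw [G.Cplus_union_Cminus]; exact w.2
  exact hw

/-- `P ∩ Q = ∅`. [folklore] -/
instance isEmpty_P_inter_Q : IsEmpty ↥(G.P ∩ G.Q) := by
  refine ⟨fun w => ?_⟩
  have h : (w.1 : Y) ∈ G.Cplus ∩ G.Cminus := w.2
  rw [G.Cplus_inter_Cminus] at h
  exact h

/-- `jA (x, s)` with `s > 1/2` as a point of `P`. [folklore] -/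
def mkP (x : N) (s : Jplus) : ↥G.P :=
  ⟨⟨G.jA (x, s.1), mem_range_self _, (G.jA_mem_range_jB_iff _).2 (ne_of_gt s.2)⟩,
    (G.jA_mem_Cplus_iff _).2 s.2⟩

/-- `jA (x, s)` with `s < 1/2` as a point of `Q`. [folklore] -/
def mkQ (x : N) (s : Jminus) : ↥G.Q :=
  ⟨⟨G.jA (x, s.1), mem_range_self _, (G.jA_mem_range_jB_iff _).2 (ne_of_lt s.2)⟩,
    (G.jA_mem_Cminus_iff _).2 s.2⟩

/-- **`P ≃ₜ N × (1/2, 1)`**: the upper overlap is a cylinder. [folklore] -/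
def homeomorphP : ↥G.P ≃ₜ N × Jplus where
  toFun w := ((G.homeomorphA.symm ⟨w.1.1, w.1.2.1⟩).1,
    ⟨(G.homeomorphA.symm ⟨w.1.1, w.1.2.1⟩).2, by
      have hw : (w.1 : Y) ∈ G.Cplus := w.2
      have hy : G.jA (G.homeomorphA.symm ⟨w.1.1, w.1.2.1⟩) = w.1.1 :=
        congrArg Subtype.val (G.homeomorphA.apply_symm_apply ⟨w.1.1, w.1.2.1⟩)
      rw [← hy] at hw
      exact (G.jA_mem_Cplus_iff _).1 hw⟩)
  invFun q := G.mkP q.1 q.2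
  left_inv w := Subtype.ext <| Subtype.ext <| by
    change G.jA (G.homeomorphA.symm ⟨w.1.1, w.1.2.1⟩) = w.1.1
    exact G.jA_homeomorphA_symm ⟨w.1.1, w.1.2.1⟩
  right_inv q := by
    obtain ⟨x, s⟩ := q
    have h : G.homeomorphA.symm ⟨G.jA (x, s.1), mem_range_self _⟩ = (x, s.1) :=
      G.homeomorphA_symm_apply _
    refine Prod.ext ?_ (Subtype.ext ?_)
    · exact (congrArg Prod.fst h :)
    · exact (congrArg Prod.snd h :)
  continuous_toFun := by
    have hc : Continuous fun w : ↥G.P => G.homeomorphA.symm ⟨w.1.1, w.1.2.1⟩ :=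
      G.homeomorphA.symm.continuous.comp (by fun_prop)
    exact (continuous_fst.comp hc).prodMk ((continuous_snd.comp hc).subtype_mk _)
  continuous_invFun :=
    ((G.continuous_jA.comp (continuous_fst.prodMk (continuous_subtype_val.comp continuous_snd))
      ).subtype_mk _).subtype_mk _

/-- **`Q ≃ₜ N × (0, 1/2)`**: the lower overlap is a cylinder. [folklore] -/
def homeomorphQ : ↥G.Q ≃ₜ N × Jminus where
  toFun w := ((G.homeomorphA.symm ⟨w.1.1, w.1.2.1⟩).1,
    ⟨(G.homeomorphA.symm ⟨w.1.1, w.1.2.1⟩).2, by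
      have hw : (w.1 : Y) ∈ G.Cminus := w.2
      have hy : G.jA (G.homeomorphA.symm ⟨w.1.1, w.1.2.1⟩) = w.1.1 :=
        congrArg Subtype.val (G.homeomorphA.apply_symm_apply ⟨w.1.1, w.1.2.1⟩)
      rw [← hy] at hw
      exact (G.jA_mem_Cminus_iff _).1 hw⟩)
  invFun q := G.mkQ q.1 q.2
  left_inv w := Subtype.ext <| Subtype.ext <| by
    change G.jA (G.homeomorphA.symm ⟨w.1.1, w.1.2.1⟩) = w.1.1
    exact G.jA_homeomorphA_symm ⟨w.1.1, w.1.2.1⟩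
  right_inv q := by
    obtain ⟨x, s⟩ := q
    have h : G.homeomorphA.symm ⟨G.jA (x, s.1), mem_range_self _⟩ = (x, s.1) :=
      G.homeomorphA_symm_apply _
    refine Prod.ext ?_ (Subtype.ext ?_)
    · exact (congrArg Prod.fst h :)
    · exact (congrArg Prod.snd h :)
  continuous_toFun := by
    have hc : Continuous fun w : ↥G.Q => G.homeomorphA.symm ⟨w.1.1, w.1.2.1⟩ :=
      G.homeomorphA.symm.continuous.comp (by fun_prop)
    exact (continuous_fst.comp hc).prodMk ((continuous_snd.comp hc).subtype_mk _)
  continuous_invFun :=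
    ((G.continuous_jA.comp (continuous_fst.prodMk (continuous_subtype_val.comp continuous_snd))
      ).subtype_mk _).subtype_mk _

/-- A base point of `(1/2, 1)`. [folklore] -/
def sPlus : Jplus := ⟨⟨3 / 4, by norm_num, by norm_num⟩, by norm_num⟩

/-- A base point of `(0, 1/2)`. [folklore] -/
def sMinus : Jminus := ⟨⟨1 / 4, by norm_num, by norm_num⟩, by norm_num⟩

/-- The section `N → P`, `x ↦ jA (x, 3/4)`. [folklore] -/
def secP : C(N, ↥G.P) where
  toFun x := G.mkP x sPlus
  continuous_toFun :=
    ((G.continuous_jA.comp (continuous_id.prodMk continuous_const)).subtype_mk _).subtype_mk _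

/-- The section `N → Q`, `x ↦ jA (x, 1/4)`. [folklore] -/
def secQ : C(N, ↥G.Q) where
  toFun x := G.mkQ x sMinus
  continuous_toFun :=
    ((G.continuous_jA.comp (continuous_id.prodMk continuous_const)).subtype_mk _).subtype_mk _

/-- The inclusion `P ⊆ W ⊆ jA(N × (0, 1))`. [folklore] -/
def inclPA : C(↥G.P, ↥(range G.jA)) where
  toFun w := ⟨w.1.1, w.1.2.1⟩

/-- The inclusion `P ⊆ W ⊆ jB(N × (1/2, 3/2))`. [folklore] -/
def inclPB : C(↥G.P, ↥(range G.jB)) where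
  toFun w := ⟨w.1.1, w.1.2.2⟩

/-- The inclusion `Q ⊆ W ⊆ jA(N × (0, 1))`. [folklore] -/
def inclQA : C(↥G.Q, ↥(range G.jA)) where
  toFun w := ⟨w.1.1, w.1.2.1⟩

/-- The inclusion `Q ⊆ W ⊆ jB(N × (1/2, 3/2))`. [folklore] -/
def inclQB : C(↥G.Q, ↥(range G.jB)) where
  toFun w := ⟨w.1.1, w.1.2.2⟩

/-- `projA ∘ (P ⊆ U) ∘ secP = id`: `projA (jA (x, 3/4)) = x`. [folklore] -/
theorem projA_comp_inclPA_comp_secP : G.projA.comp (G.inclPA.comp G.secP) = ContinuousMap.id N := by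
  ext x
  exact G.projA_apply_jA (x, sPlus.1)

/-- `projB ∘ (P ⊆ V) ∘ secP = id`: `projB (jA (x, 3/4)) = projB (jB (x, 3/4)) = x`. [folklore] -/
theorem projB_comp_inclPB_comp_secP : G.projB.comp (G.inclPB.comp G.secP) = ContinuousMap.id N := by
  ext x
  change G.projB ⟨G.jA (x, sPlus.1), _⟩ = x
  rw [G.projB_eq_projA_of_mem_Cplus ((G.jA_mem_Cplus_iff _).2 sPlus.2) (mem_range_self _)]
  exact G.projA_apply_jA (x, sPlus.1)

/-- `projA ∘ (Q ⊆ U) ∘ secQ = id`: `projA (jA (x, 1/4)) = x`. [folklore] -/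
theorem projA_comp_inclQA_comp_secQ : G.projA.comp (G.inclQA.comp G.secQ) = ContinuousMap.id N := by
  ext x
  exact G.projA_apply_jA (x, sMinus.1)

/-- `projB ∘ (Q ⊆ V) ∘ secQ = ψ`: `projB (jA (x, 1/4)) = projB (jB (ψ x, 5/4)) = ψ x` (the monodromy
appears on the lower overlap). [folklore] -/
theorem projB_comp_inclQB_comp_secQ (hψ : Continuous ψ) :
    G.projB.comp (G.inclQB.comp G.secQ) = ⟨ψ, hψ⟩ := by
  ext x
  change G.projB ⟨G.jA (x, sMinus.1), _⟩ = ψ x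
  rw [G.projB_eq_apply_projA_of_mem_Cminus ((G.jA_mem_Cminus_iff _).2 sMinus.2) (mem_range_self _)]
  exact congrArg ψ (G.projA_apply_jA (x, sMinus.1))

/-- `projA = fst ∘ homeomorphA⁻¹` is induced by a homotopy equivalence (the interval factor is
contractible). [folklore] -/
theorem projA_eq : G.projA = (G.homeomorphA.symm.toHomotopyEquiv.trans
    (HomotopyEquiv.fstOfContractible N ↥mappingTorusPieceOne)).toFun := rfl

/-- `projB = fst ∘ homeomorphB⁻¹` is induced by a homotopy equivalence. [folklore] -/
theorem projB_eq : G.projB = (G.homeomorphB.symm.toHomotopyEquiv.trans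
    (HomotopyEquiv.fstOfContractible N ↥mappingTorusPieceTwo)).toFun := rfl

/-- `fst ∘ homeomorphP ∘ secP = id` (so `secP` induces isomorphisms on homology). [folklore] -/
theorem fst_homeomorphP_secP (x : N) : (G.homeomorphP (G.secP x)).1 = x :=
  congrArg Prod.fst (G.homeomorphP.apply_symm_apply (x, sPlus))

/-- `fst ∘ homeomorphQ ∘ secQ = id`. [folklore] -/
theorem fst_homeomorphQ_secQ (x : N) : (G.homeomorphQ (G.secQ x)).1 = x :=
  congrArg Prod.fst (G.homeomorphQ.apply_symm_apply (x, sMinus))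

end MappingTorusDatum

end Cylinders

end Literature.Topology.FourManifolds

namespace Literature.Topology.FourManifolds

/-! ### Homology: the empty space, additivity over the overlaps, the Wang matrix -/

section Homology

variable (R : Type v) [CommRing R] (M : Type v) [AddCommGroup M] [Module R M]

/-- The singular homology of an empty space vanishes in every degree (there are no singular
simplices; Hatcher, *Algebraic Topology*, §2.1). [folklore] -/
theorem isZero_singularHomology_of_isEmpty (X : Type u) [TopologicalSpace X] [IsEmpty X] (n : ℕ) :
    IsZero (Literature.AlgebraicTopology.SingularHomology.singularHomology R M X n) := by
  have hX : IsZero ((Literature.AlgebraicTopology.SingularHomology.singularChainComplex R M X).X n) := by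
    rw [IsZero.iff_id_eq_zero]
    exact Literature.AlgebraicTopology.SingularHomology.singularChainComplex.hom_ext fun σ _ =>
      isEmptyElim (Literature.AlgebraicTopology.SingularHomology.SingularSimplex.toContinuousMap σ (Classical.arbitrary _))
  exact ShortComplex.isZero_homology_of_isZero_X₂ _ hX

variable {N : Type u} [TopologicalSpace N] (ψ : C(N, N))

omit [TopologicalSpace N] in
/-- A biproduct of isomorphisms is an isomorphism (`biprod.mapIso`). [folklore] -/
theorem isIso_biprod_map {C : Type*} [Category C] [HasZeroMorphisms C] [HasBinaryBiproducts C]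
    {W X Y' Z : C} (f : W ⟶ Y') (g : X ⟶ Z) [IsIso f] [IsIso g] : IsIso (biprod.map f g) := by
  change IsIso (biprod.mapIso (asIso f) (asIso g)).hom
  infer_instance

/-- **The Wang matrix** `L = [[1, 1], [-1, -ψ_*]]` on `Hₖ(N) ⊞ Hₖ(N)`: the Mayer–Vietoris map
`Hₖ(C₊) ⊞ Hₖ(C₋) → Hₖ(U) ⊞ Hₖ(V)` of a glued mapping torus, read through the identifications of the
four cylinders with `N` (`wangMatrix_eq`). (Hatcher, *Algebraic Topology*, Ex. 2.48: the
Mayer–Vietoris sequence of a mapping torus has the form `… → Hₙ(X) ⊕ Hₙ(X) →(1 1; 1 f_*) …`.)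
[cite: HatcherAT2002, §2.2 Ex. 2.48] -/
def wangMatrix (k : ℕ) : Literature.AlgebraicTopology.SingularHomology.singularHomology R M N k ⊞ Literature.AlgebraicTopology.SingularHomology.singularHomology R M N k ⟶
    Literature.AlgebraicTopology.SingularHomology.singularHomology R M N k ⊞ Literature.AlgebraicTopology.SingularHomology.singularHomology R M N k :=
  biprod.lift (biprod.desc (𝟙 _) (𝟙 _)) (biprod.desc (-𝟙 _) (-Literature.AlgebraicTopology.SingularHomology.singularHomology.map R M ψ k))

/-- `L (a, b) = 0` forces `b = -a` and `(ψ_* - 1) a = 0`: **`L` is a monomorphism if `ψ_* - 1` is.**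
[folklore] -/
theorem mono_wangMatrix (k : ℕ) [Mono (Literature.AlgebraicTopology.SingularHomology.singularHomology.map R M ψ k - 𝟙 _)] :
    Mono (wangMatrix R M ψ k) := by
  refine Preadditive.mono_of_cancel_zero _ fun {T} t ht => ?_
  set t₁ := t ≫ biprod.fst with ht₁
  set t₂ := t ≫ biprod.snd with ht₂
  have ht' : t = biprod.lift t₁ t₂ := by apply biprod.hom_ext <;> simp [t₁, t₂]
  rw [ht', wangMatrix] at ht
  have h1 := congrArg (· ≫ biprod.fst) ht
  have h2 := congrArg (· ≫ biprod.snd) ht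
  simp only [Category.assoc, biprod.lift_fst, biprod.lift_snd, biprod.lift_desc, Category.comp_id,
    zero_comp, Preadditive.comp_neg] at h1 h2
  -- `h1 : t₁ + t₂ = 0`, `h2 : -t₁ + -(t₂ ≫ ψ_*) = 0`
  have ht₂' : t₂ = -t₁ := eq_neg_of_add_eq_zero_right h1
  have h3 : t₁ ≫ (Literature.AlgebraicTopology.SingularHomology.singularHomology.map R M ψ k - 𝟙 _) = 0 := by
    rw [ht₂', Preadditive.neg_comp, neg_neg] at h2
    rw [Preadditive.comp_sub, Category.comp_id, sub_eq_neg_add]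
    exact h2
  have h4 : t₁ = 0 := zero_of_comp_mono _ h3
  rw [ht', ht₂', h4, neg_zero]
  apply biprod.hom_ext <;> simp

/-- `L ≫ g = 0` forces `g₁ = g₂` and `(ψ_* - 1) ≫ g₂ = 0`: **`L` is an epimorphism if `ψ_* - 1`
is.** [folklore] -/
theorem epi_wangMatrix (k : ℕ) [Epi (Literature.AlgebraicTopology.SingularHomology.singularHomology.map R M ψ k - 𝟙 _)] :
    Epi (wangMatrix R M ψ k) := by
  refine Preadditive.epi_of_cancel_zero _ fun {T} g hg => ?_
  set g₁ := biprod.inl ≫ g with hg₁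
  set g₂ := biprod.inr ≫ g with hg₂
  have hg' : g = biprod.desc g₁ g₂ := by apply biprod.hom_ext' <;> simp [g₁, g₂]
  rw [hg', wangMatrix, biprod.lift_desc] at hg
  have h1 := congrArg (biprod.inl ≫ ·) hg
  have h2 := congrArg (biprod.inr ≫ ·) hg
  simp only [Preadditive.comp_add, biprod.inl_desc_assoc, biprod.inr_desc_assoc, Category.id_comp,
    Preadditive.neg_comp, comp_zero] at h1 h2
  -- `h1 : g₁ + -g₂ = 0`, `h2 : g₁ + -(ψ_* ≫ g₂) = 0`
  have hg₁' : g₁ = g₂ := by rwa [← sub_eq_add_neg, sub_eq_zero] at h1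
  have h3 : (Literature.AlgebraicTopology.SingularHomology.singularHomology.map R M ψ k - 𝟙 _) ≫ g₂ = 0 := by
    rw [hg₁'] at h2
    rw [Preadditive.sub_comp, Category.id_comp, sub_eq_zero, eq_comm, ← sub_eq_zero, sub_eq_add_neg]
    exact h2
  have h4 : g₂ = 0 := zero_of_epi_comp _ h3
  rw [hg', hg₁', h4]
  apply biprod.hom_ext' <;> simp

variable {ψ} {Y : Type u} [TopologicalSpace Y] (G : MappingTorusDatum ψ Y)

namespace MappingTorusDatum

/-- **Additivity over the two overlaps**: the Mayer–Vietoris map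
`Hₙ₊₁(P) ⊞ Hₙ₊₁(Q) → Hₙ₊₁(W)` of the cover of the overlap `W` by the disjoint open cylinders
`P = C₊`, `Q = C₋` is an isomorphism (`P ∩ Q = ∅` has zero homology; Mayer–Vietoris exactness
`exact₁`, `exact₂` for `(P, Q)` in `W` are hypotheses) (Hatcher, *Algebraic Topology*, §2.2,
p. 149). [cite: HatcherAT2002, §2.2 p. 149] -/
theorem isIso_ψ_overlap
    (hexc : Literature.AlgebraicTopology.SingularHomology.relativeSingularHomology.isIso_map_of_interior_union_interior R M ↥G.overlap)
    (h₁ : Literature.AlgebraicTopology.SingularHomology.mayerVietoris.exact₁ R M G.P G.Q) (h₂ : Literature.AlgebraicTopology.SingularHomology.mayerVietoris.exact₂ R M G.P G.Q) (n : ℕ) :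
    IsIso (Literature.AlgebraicTopology.SingularHomology.mayerVietoris.ψ R M G.P G.Q (n + 1)) := by
  have hz : ∀ k, IsZero (Literature.AlgebraicTopology.SingularHomology.singularHomology R M ↥(G.P ∩ G.Q) k) :=
    fun k => isZero_singularHomology_of_isEmpty R M _ k
  haveI : Mono (Literature.AlgebraicTopology.SingularHomology.mayerVietoris.ψ R M G.P G.Q (n + 1)) :=
    (h₁ G.interior_P_union_interior_Q (n + 1)).mono_g ((hz (n + 1)).eq_of_src _ _)
  haveI : Epi (Literature.AlgebraicTopology.SingularHomology.mayerVietoris.ψ R M G.P G.Q (n + 1)) :=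
    (h₂ hexc G.interior_P_union_interior_Q n).epi_f ((hz n).eq_of_tgt _ _)
  exact isIso_of_mono_of_epi _

/-- `projA` induces isomorphisms on homology (it is a homotopy equivalence). [folklore] -/
instance isIso_map_projA (k : ℕ) : IsIso (Literature.AlgebraicTopology.SingularHomology.singularHomology.map R M G.projA k) := by
  rw [projA_eq, ← Literature.AlgebraicTopology.SingularHomology.singularHomology.isoOfHomotopyEquiv_hom]
  infer_instance

/-- `projB` induces isomorphisms on homology (it is a homotopy equivalence). [folklore] -/
instance isIso_map_projB (k : ℕ) : IsIso (Literature.AlgebraicTopology.SingularHomology.singularHomology.map R M G.projB k) := by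
  rw [projB_eq, ← Literature.AlgebraicTopology.SingularHomology.singularHomology.isoOfHomotopyEquiv_hom]
  infer_instance

/-- The retraction `P ≅ N × (1/2, 1) → N` of `secP`. [folklore] -/
def retP : C(↥G.P, N) :=
  (HomotopyEquiv.fstOfContractible N Jplus).toFun.comp (G.homeomorphP : C(↥G.P, N × Jplus))

/-- The retraction `Q ≅ N × (0, 1/2) → N` of `secQ`. [folklore] -/
def retQ : C(↥G.Q, N) :=
  (HomotopyEquiv.fstOfContractible N Jminus).toFun.comp (G.homeomorphQ : C(↥G.Q, N × Jminus))

/-- `retP ∘ secP = id`. [folklore] -/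
theorem retP_comp_secP : G.retP.comp G.secP = ContinuousMap.id N := by
  ext x
  exact G.fst_homeomorphP_secP x

/-- `retQ ∘ secQ = id`. [folklore] -/
theorem retQ_comp_secQ : G.retQ.comp G.secQ = ContinuousMap.id N := by
  ext x
  exact G.fst_homeomorphQ_secQ x

/-- `retP` induces isomorphisms on homology. [folklore] -/
instance isIso_map_retP (k : ℕ) : IsIso (Literature.AlgebraicTopology.SingularHomology.singularHomology.map R M G.retP k) := by
  rw [retP, Literature.AlgebraicTopology.SingularHomology.singularHomology.map_comp, ← Literature.AlgebraicTopology.SingularHomology.singularHomology.mapIso_hom,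
    ← Literature.AlgebraicTopology.SingularHomology.singularHomology.isoOfHomotopyEquiv_hom]
  infer_instance

/-- `retQ` induces isomorphisms on homology. [folklore] -/
instance isIso_map_retQ (k : ℕ) : IsIso (Literature.AlgebraicTopology.SingularHomology.singularHomology.map R M G.retQ k) := by
  rw [retQ, Literature.AlgebraicTopology.SingularHomology.singularHomology.map_comp, ← Literature.AlgebraicTopology.SingularHomology.singularHomology.mapIso_hom,
    ← Literature.AlgebraicTopology.SingularHomology.singularHomology.isoOfHomotopyEquiv_hom]
  infer_instance

/-- `secP` induces isomorphisms on homology (`retP ∘ secP = id` with `retP` a homotopy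
equivalence). [folklore] -/
instance isIso_map_secP (k : ℕ) : IsIso (Literature.AlgebraicTopology.SingularHomology.singularHomology.map R M G.secP k) := by
  have hfac : Literature.AlgebraicTopology.SingularHomology.singularHomology.map R M G.secP k ≫ Literature.AlgebraicTopology.SingularHomology.singularHomology.map R M G.retP k = 𝟙 _ := by
    rw [← Literature.AlgebraicTopology.SingularHomology.singularHomology.map_comp, G.retP_comp_secP, Literature.AlgebraicTopology.SingularHomology.singularHomology.map_id]
  haveI : IsIso (Literature.AlgebraicTopology.SingularHomology.singularHomology.map R M G.secP k ≫ Literature.AlgebraicTopology.SingularHomology.singularHomology.map R M G.retP k) := by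
    rw [hfac]; infer_instance
  exact IsIso.of_isIso_comp_right _ (Literature.AlgebraicTopology.SingularHomology.singularHomology.map R M G.retP k)

/-- `secQ` induces isomorphisms on homology. [folklore] -/
instance isIso_map_secQ (k : ℕ) : IsIso (Literature.AlgebraicTopology.SingularHomology.singularHomology.map R M G.secQ k) := by
  have hfac : Literature.AlgebraicTopology.SingularHomology.singularHomology.map R M G.secQ k ≫ Literature.AlgebraicTopology.SingularHomology.singularHomology.map R M G.retQ k = 𝟙 _ := by
    rw [← Literature.AlgebraicTopology.SingularHomology.singularHomology.map_comp, G.retQ_comp_secQ, Literature.AlgebraicTopology.SingularHomology.singularHomology.map_id]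
  haveI : IsIso (Literature.AlgebraicTopology.SingularHomology.singularHomology.map R M G.secQ k ≫ Literature.AlgebraicTopology.SingularHomology.singularHomology.map R M G.retQ k) := by
    rw [hfac]; infer_instance
  exact IsIso.of_isIso_comp_right _ (Literature.AlgebraicTopology.SingularHomology.singularHomology.map R M G.retQ k)

/-- The comparison of the Mayer–Vietoris map `φ ∘ ψ_W : Hₖ(P) ⊞ Hₖ(Q) → Hₖ(U) ⊞ Hₖ(V)` with the
Wang matrix: precomposed with the sections and followed by the fibre projections it *is*
`[[1, 1], [-1, -ψ_*]]`, because `projA ∘ secP = projB ∘ secP = projA ∘ secQ = id` and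
`projB ∘ secQ = ψ` (Hatcher, *Algebraic Topology*, Ex. 2.48). [cite: HatcherAT2002, §2.2 Ex. 2.48] -/
theorem wangMatrix_eq (k : ℕ) :
    biprod.map (Literature.AlgebraicTopology.SingularHomology.singularHomology.map R M G.secP k) (Literature.AlgebraicTopology.SingularHomology.singularHomology.map R M G.secQ k) ≫
      Literature.AlgebraicTopology.SingularHomology.mayerVietoris.ψ R M G.P G.Q k ≫ Literature.AlgebraicTopology.SingularHomology.mayerVietoris.φ R M (range G.jA) (range G.jB) k ≫
        biprod.map (Literature.AlgebraicTopology.SingularHomology.singularHomology.map R M G.projA k) (Literature.AlgebraicTopology.SingularHomology.singularHomology.map R M G.projB k) =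
      wangMatrix R M ψ k := by
  apply biprod.hom_ext' <;> apply biprod.hom_ext
  · -- (inl, fst): `projA ∘ inclPA ∘ secP = id`
    simp only [wangMatrix, Category.assoc, biprod.inl_map_assoc, Literature.AlgebraicTopology.SingularHomology.mayerVietoris.ψ,
      biprod.inl_desc_assoc, Literature.AlgebraicTopology.SingularHomology.mayerVietoris.φ, biprod.lift_fst_assoc, biprod.map_fst,
      biprod.lift_fst, biprod.inl_desc]
    simp only [← Literature.AlgebraicTopology.SingularHomology.singularHomology.map_comp]
    have e : (G.projA.comp (Literature.AlgebraicTopology.SingularHomology.subsetInclusion (inter_subset_left : G.overlap ⊆ range G.jA))).comp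
        ((Literature.AlgebraicTopology.SingularHomology.subsetIncl G.P).comp G.secP) = ContinuousMap.id N := G.projA_comp_inclPA_comp_secP
    change Literature.AlgebraicTopology.SingularHomology.singularHomology.map R M ((G.projA.comp (Literature.AlgebraicTopology.SingularHomology.subsetInclusion
      (inter_subset_left : G.overlap ⊆ range G.jA))).comp ((Literature.AlgebraicTopology.SingularHomology.subsetIncl G.P).comp G.secP)) k = _
    rw [e, Literature.AlgebraicTopology.SingularHomology.singularHomology.map_id]
  · -- (inl, snd): `projB ∘ inclPB ∘ secP = id`
    simp only [wangMatrix, Category.assoc, biprod.inl_map_assoc, Literature.AlgebraicTopology.SingularHomology.mayerVietoris.ψ,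
      biprod.inl_desc_assoc, Literature.AlgebraicTopology.SingularHomology.mayerVietoris.φ, biprod.lift_snd_assoc, biprod.map_snd,
      biprod.lift_snd, biprod.inl_desc, Preadditive.neg_comp]
    simp only [Preadditive.comp_neg, ← Literature.AlgebraicTopology.SingularHomology.singularHomology.map_comp]
    have e : (G.projB.comp (Literature.AlgebraicTopology.SingularHomology.subsetInclusion (inter_subset_right : G.overlap ⊆ range G.jB))).comp
        ((Literature.AlgebraicTopology.SingularHomology.subsetIncl G.P).comp G.secP) = ContinuousMap.id N := G.projB_comp_inclPB_comp_secP
    change -Literature.AlgebraicTopology.SingularHomology.singularHomology.map R M ((G.projB.comp (Literature.AlgebraicTopology.SingularHomology.subsetInclusion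
      (inter_subset_right : G.overlap ⊆ range G.jB))).comp ((Literature.AlgebraicTopology.SingularHomology.subsetIncl G.P).comp G.secP)) k = _
    rw [e, Literature.AlgebraicTopology.SingularHomology.singularHomology.map_id]
  · -- (inr, fst): `projA ∘ inclQA ∘ secQ = id`
    simp only [wangMatrix, Category.assoc, biprod.inr_map_assoc, Literature.AlgebraicTopology.SingularHomology.mayerVietoris.ψ,
      biprod.inr_desc_assoc, Literature.AlgebraicTopology.SingularHomology.mayerVietoris.φ, biprod.lift_fst_assoc, biprod.map_fst,
      biprod.lift_fst, biprod.inr_desc]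
    simp only [← Literature.AlgebraicTopology.SingularHomology.singularHomology.map_comp]
    have e : (G.projA.comp (Literature.AlgebraicTopology.SingularHomology.subsetInclusion (inter_subset_left : G.overlap ⊆ range G.jA))).comp
        ((Literature.AlgebraicTopology.SingularHomology.subsetIncl G.Q).comp G.secQ) = ContinuousMap.id N := G.projA_comp_inclQA_comp_secQ
    change Literature.AlgebraicTopology.SingularHomology.singularHomology.map R M ((G.projA.comp (Literature.AlgebraicTopology.SingularHomology.subsetInclusion
      (inter_subset_left : G.overlap ⊆ range G.jA))).comp ((Literature.AlgebraicTopology.SingularHomology.subsetIncl G.Q).comp G.secQ)) k = _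
    rw [e, Literature.AlgebraicTopology.SingularHomology.singularHomology.map_id]
  · -- (inr, snd): `projB ∘ inclQB ∘ secQ = ψ`
    simp only [wangMatrix, Category.assoc, biprod.inr_map_assoc, Literature.AlgebraicTopology.SingularHomology.mayerVietoris.ψ,
      biprod.inr_desc_assoc, Literature.AlgebraicTopology.SingularHomology.mayerVietoris.φ, biprod.lift_snd_assoc, biprod.map_snd,
      biprod.lift_snd, biprod.inr_desc, Preadditive.neg_comp]
    simp only [Preadditive.comp_neg, ← Literature.AlgebraicTopology.SingularHomology.singularHomology.map_comp]
    have e : (G.projB.comp (Literature.AlgebraicTopology.SingularHomology.subsetInclusion (inter_subset_right : G.overlap ⊆ range G.jB))).comp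
        ((Literature.AlgebraicTopology.SingularHomology.subsetIncl G.Q).comp G.secQ) = ψ := G.projB_comp_inclQB_comp_secQ ψ.continuous
    change -Literature.AlgebraicTopology.SingularHomology.singularHomology.map R M ((G.projB.comp (Literature.AlgebraicTopology.SingularHomology.subsetInclusion
      (inter_subset_right : G.overlap ⊆ range G.jB))).comp ((Literature.AlgebraicTopology.SingularHomology.subsetIncl G.Q).comp G.secQ)) k = _
    rw [e]

/-- **The vanishing criterion of the Wang sequence, degree 2.** Let `Y` be a glued mapping torus of
`ψ : N → N` (`MappingTorusDatum`). If `ψ_* - 1` is injective on `H₁(N; M)` and surjective on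
`H₂(N; M)`, then `H₂(Y; M) = 0`. Proof: in the Mayer–Vietoris sequence of
`Y = jA(N × (0, 1)) ∪ jB(N × (1/2, 3/2))`,
`H₂(W) →φ₂ H₂(U) ⊞ H₂(V) → H₂(Y) → H₁(W) →φ₁ H₁(U) ⊞ H₁(V)`, the overlap `W` is the disjoint union
of two cylinders (`isIso_ψ_overlap`) and `φₖ` becomes the Wang matrix `[[1, 1], [-1, -ψ_*]]`
(`wangMatrix_eq`), which is mono for `k = 1` and epi for `k = 2` (`mono_wangMatrix`,
`epi_wangMatrix`); hence `H₂(U) ⊞ H₂(V) → H₂(Y)` is zero and (by exactness at `H₂(Y)` and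
`δ ≫ φ₁ = 0`) surjective. This is the `n = 2` case of the exact sequence
`Hₙ(X) →(1 - f_*) Hₙ(X) → Hₙ(T_f) → Hₙ₋₁(X) →(1 - f_*) Hₙ₋₁(X)` of a mapping torus (Hatcher,
*Algebraic Topology*, §2.2, Ex. 2.48). Excision and the Mayer–Vietoris exactness facts of
`ExcisionMayerVietoris.lean` are hypotheses. [cite: HatcherAT2002, §2.2 Ex. 2.48] -/
theorem isZero_singularHomology_two
    (hexcY : Literature.AlgebraicTopology.SingularHomology.relativeSingularHomology.isIso_map_of_interior_union_interior R M Y)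
    (hexcW : Literature.AlgebraicTopology.SingularHomology.relativeSingularHomology.isIso_map_of_interior_union_interior R M ↥G.overlap)
    (h₂Y : Literature.AlgebraicTopology.SingularHomology.mayerVietoris.exact₂ R M (range G.jA) (range G.jB))
    (h₁W : Literature.AlgebraicTopology.SingularHomology.mayerVietoris.exact₁ R M G.P G.Q) (h₂W : Literature.AlgebraicTopology.SingularHomology.mayerVietoris.exact₂ R M G.P G.Q)
    [Mono (Literature.AlgebraicTopology.SingularHomology.singularHomology.map R M ψ 1 - 𝟙 _)] [Epi (Literature.AlgebraicTopology.SingularHomology.singularHomology.map R M ψ 2 - 𝟙 _)] :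
    IsZero (Literature.AlgebraicTopology.SingularHomology.singularHomology R M Y 2) := by
  have hcov : interior (range G.jA) ∪ interior (range G.jB) = univ := by
    rw [G.hAo.interior_eq, G.hBo.interior_eq, G.hU]
  haveI hψW1 : IsIso (Literature.AlgebraicTopology.SingularHomology.mayerVietoris.ψ R M G.P G.Q 1) := G.isIso_ψ_overlap R M hexcW h₁W h₂W 0
  haveI hψW2 : IsIso (Literature.AlgebraicTopology.SingularHomology.mayerVietoris.ψ R M G.P G.Q 2) := G.isIso_ψ_overlap R M hexcW h₁W h₂W 1
  haveI hS : ∀ k, IsIso (biprod.map (Literature.AlgebraicTopology.SingularHomology.singularHomology.map R M G.secP k)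
      (Literature.AlgebraicTopology.SingularHomology.singularHomology.map R M G.secQ k)) := fun k => isIso_biprod_map _ _
  haveI hRr : ∀ k, IsIso (biprod.map (Literature.AlgebraicTopology.SingularHomology.singularHomology.map R M G.projA k)
      (Literature.AlgebraicTopology.SingularHomology.singularHomology.map R M G.projB k)) := fun k => isIso_biprod_map _ _
  haveI : Mono (wangMatrix R M ψ 1) := mono_wangMatrix R M ψ 1
  haveI : Epi (wangMatrix R M ψ 2) := epi_wangMatrix R M ψ 2
  -- `φ₁` is a monomorphism
  have e1 : Literature.AlgebraicTopology.SingularHomology.mayerVietoris.φ R M (range G.jA) (range G.jB) 1 ≫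
      biprod.map (Literature.AlgebraicTopology.SingularHomology.singularHomology.map R M G.projA 1) (Literature.AlgebraicTopology.SingularHomology.singularHomology.map R M G.projB 1) =
        inv (Literature.AlgebraicTopology.SingularHomology.mayerVietoris.ψ R M G.P G.Q 1) ≫
          inv (biprod.map (Literature.AlgebraicTopology.SingularHomology.singularHomology.map R M G.secP 1) (Literature.AlgebraicTopology.SingularHomology.singularHomology.map R M G.secQ 1)) ≫
            wangMatrix R M ψ 1 := by
    rw [← G.wangMatrix_eq R M 1]
    simp
  haveI : Mono (Literature.AlgebraicTopology.SingularHomology.mayerVietoris.φ R M (range G.jA) (range G.jB) 1 ≫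
      biprod.map (Literature.AlgebraicTopology.SingularHomology.singularHomology.map R M G.projA 1) (Literature.AlgebraicTopology.SingularHomology.singularHomology.map R M G.projB 1)) := by
    rw [e1]; infer_instance
  haveI hφ1 : Mono (Literature.AlgebraicTopology.SingularHomology.mayerVietoris.φ R M (range G.jA) (range G.jB) 1) :=
    mono_of_mono _ (biprod.map (Literature.AlgebraicTopology.SingularHomology.singularHomology.map R M G.projA 1) (Literature.AlgebraicTopology.SingularHomology.singularHomology.map R M G.projB 1))
  -- `φ₂` is an epimorphism
  have e2 : biprod.map (Literature.AlgebraicTopology.SingularHomology.singularHomology.map R M G.secP 2) (Literature.AlgebraicTopology.SingularHomology.singularHomology.map R M G.secQ 2) ≫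
      Literature.AlgebraicTopology.SingularHomology.mayerVietoris.ψ R M G.P G.Q 2 ≫ Literature.AlgebraicTopology.SingularHomology.mayerVietoris.φ R M (range G.jA) (range G.jB) 2 =
        wangMatrix R M ψ 2 ≫
          inv (biprod.map (Literature.AlgebraicTopology.SingularHomology.singularHomology.map R M G.projA 2) (Literature.AlgebraicTopology.SingularHomology.singularHomology.map R M G.projB 2)) := by
    rw [← G.wangMatrix_eq R M 2]
    simp
  haveI : Epi (biprod.map (Literature.AlgebraicTopology.SingularHomology.singularHomology.map R M G.secP 2) (Literature.AlgebraicTopology.SingularHomology.singularHomology.map R M G.secQ 2) ≫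
      Literature.AlgebraicTopology.SingularHomology.mayerVietoris.ψ R M G.P G.Q 2 ≫ Literature.AlgebraicTopology.SingularHomology.mayerVietoris.φ R M (range G.jA) (range G.jB) 2) := by
    rw [e2]; infer_instance
  haveI : Epi (Literature.AlgebraicTopology.SingularHomology.mayerVietoris.ψ R M G.P G.Q 2 ≫ Literature.AlgebraicTopology.SingularHomology.mayerVietoris.φ R M (range G.jA) (range G.jB) 2) :=
    epi_of_epi (biprod.map (Literature.AlgebraicTopology.SingularHomology.singularHomology.map R M G.secP 2) (Literature.AlgebraicTopology.SingularHomology.singularHomology.map R M G.secQ 2)) _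
  haveI hφ2 : Epi (Literature.AlgebraicTopology.SingularHomology.mayerVietoris.φ R M (range G.jA) (range G.jB) 2) :=
    epi_of_epi (Literature.AlgebraicTopology.SingularHomology.mayerVietoris.ψ R M G.P G.Q 2) _
  -- conclude from the Mayer–Vietoris sequence of `(U, V)` in `Y`
  have hδ : Literature.AlgebraicTopology.SingularHomology.mayerVietoris.δ R M (range G.jA) (range G.jB) hexcY hcov 1 = 0 :=
    zero_of_comp_mono _ (Literature.AlgebraicTopology.SingularHomology.mayerVietoris.δ_comp_φ R M _ _ hexcY hcov 1)
  have hψ : Literature.AlgebraicTopology.SingularHomology.mayerVietoris.ψ R M (range G.jA) (range G.jB) 2 = 0 :=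
    zero_of_epi_comp _ (Literature.AlgebraicTopology.SingularHomology.mayerVietoris.φ_comp_ψ R M _ _ 2)
  haveI hepi : Epi (Literature.AlgebraicTopology.SingularHomology.mayerVietoris.ψ R M (range G.jA) (range G.jB) 2) := (h₂Y hexcY hcov 1).epi_f hδ
  rw [hψ] at hepi
  exact IsZero.of_epi_zero
    (Literature.AlgebraicTopology.SingularHomology.singularHomology R M ↥(range G.jA) 2 ⊞ Literature.AlgebraicTopology.SingularHomology.singularHomology R M ↥(range G.jB) 2) _

end MappingTorusDatum

end Homology

end Literature.Topology.FourManifolds
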